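import Summits.ResolutionOfSingularities.ResolutionOfSingularities.Theorems.RadicialJungCleanModelsCleanSpreadsDualDerivations
import Summits.ResolutionOfSingularities.ResolutionOfSingularities.Theorems.RadicialJungCleanModelsCleanSpreadsRegularTypeMechanism
import Literature.AlgebraicGeometry.Resolution.DerivativeIdealsLocalization
import HarnessLib

/-!
# Crux stmt-ResolutionOfSingularities-15917 (`RadicialJung.CleanModels`), stub `stub_cleanSpreads`,
# part 2: spreading regular types

Support file for the stub `stub_cleanSpreads` (line `Sketch`, rev 7). Let `A` be a finitely
generated `k`-domain of characteristic `p`, `𝔭` a maximal ideal with `A_𝔭` regular, `K` an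
`A`-algebra and `x ∈ K`.

* `spreads_of_parameter` — **case (iii)**: `x = s` with `s - c^p = a_0` a member of a regular
  system of parameters of `A_𝔭`: the derivation `E_0` dual to `a_0`
  (`exists_derivations_dual_of_finiteType`) has `E_0(s) = e ∉ 𝔭`, so `x` is of regular type at
  every `A_𝔮` with `e ∉ 𝔮` (`regularType_of_derivation_apply_notMem`).
* `exists_derivation_apply_notMem`, `spreads_of_unit` — **case (ii)**: `x = u` a unit whose residue
  is not a `p`-th power: in `A[Y]` the kernel `𝔔` of `A[Y] → κ(𝔭)[Y]/(Y^p - ū)` is a maximal ideal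
  of height `d + 1` with `𝔔 A[Y]_𝔔 = (Y^p - u, a)`, so `A[Y]_𝔔` is regular, and the derivation dual
  to `Y^p - u`, restricted to `A` and followed by a coefficient functional, is an `E ∈ Der(A)` with
  `E(u) ∉ 𝔭`.

In each case the conclusion is: for some `h ∉ 𝔭`, `x` is loosely clean at every regular
localisation `A_𝔮` (`h ∉ 𝔮`, `𝔮 ≠ 𝔭`) mapping to `K`.
-/

noncomputable section

set_option linter.dupNamespace false -- mandated namespace of this single-conjunct summit

open IsLocalRing Literature.AlgebraicGeometry.Resolution

namespace Summit.ResolutionOfSingularities.ResolutionOfSingularities.Theorems.RadicialJung.CleanModels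

universe u v w

/-! ## Regular types spread -/

/-- **Case (iii): `x = s`, `s - c^p` a regular parameter at `v`.** If `s - c^p = a_0` is a member
of a regular system of parameters `a` of `A_𝔭` taken from `A`, then with `E_0` dual to `a_0`
(`exists_derivations_dual_of_finiteType`), `E_0(s) = e ∉ 𝔭`, and `x` is of regular type at every
`A_𝔮` with `e ∉ 𝔮`. -/
theorem spreads_of_parameter (k : Type u) [Field k] (p : ℕ) (hp : p.Prime) {A : Type u}
    [CommRing A] [IsDomain A] [CharP A p] [Algebra k A] [Algebra.FiniteType k A]
    {K : Type w} [CommRing K] [Algebra A K] (𝔭 : Ideal A) [𝔭.IsMaximal]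
    (O : Type v) [CommRing O] [Algebra A O] [IsLocalization.AtPrime O 𝔭] [IsRegularLocalRing O]
    (x : K) {d : ℕ} (hd0 : 0 < d) (a : Fin d → A) (s c : A)
    (ha : Ideal.span (Set.range fun i => algebraMap A O (a i)) = maximalIdeal O)
    (hd : ringKrullDim O = d) (ha0 : a ⟨0, hd0⟩ = s - c ^ p) (hx : x = algebraMap A K s) :
    ∃ h : A, h ∉ 𝔭 ∧ ∀ (𝔮 : Ideal A) [𝔮.IsPrime], h ∉ 𝔮 → 𝔮 ≠ 𝔭 →
      ∀ (O' : Type v) [CommRing O'] [Algebra A O'] [IsLocalization.AtPrime O' 𝔮]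
        [IsRegularLocalRing O'] [Algebra O' K] [IsScalarTower A O' K],
      ((∃ (d m : ℕ) (hmd : m ≤ d) (t : Fin d → O') (a : Fin m → ℕ) (u : O'), IsUnit u ∧
          Ideal.span (Set.range t) = maximalIdeal O' ∧
          ringKrullDim O' = (d : WithBot ℕ∞) ∧ 0 < m ∧ (∀ i, ¬ p ∣ a i) ∧
          x = algebraMap O' K (u * ∏ i : Fin m, t (Fin.castLE hmd i) ^ (a i))) ∨
        (∃ u : O', IsUnit u ∧ x = algebraMap O' K u ∧
          ∀ c' : O', u - c' ^ p ∉ maximalIdeal O') ∨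
        (∃ s c' : O', x = algebraMap O' K s ∧
          s - c' ^ p ∈ maximalIdeal O' ∧ s - c' ^ p ∉ maximalIdeal O' ^ 2)) := by
  obtain ⟨E, e, he, hE⟩ := exists_derivations_dual_of_finiteType k 𝔭 O a ha hd
  have hEs : E ⟨0, hd0⟩ s = e := by
    have h1 : s = a ⟨0, hd0⟩ + c ^ p := by rw [ha0]; ring
    rw [h1, map_add, hE, if_pos rfl, derivation_apply_pow_charP p, add_zero]
  refine ⟨e, he, fun 𝔮 _ heq _ O' _ _ _ _ _ _ => Or.inr ?_⟩
  exact regularType_of_derivation_apply_notMem p hp (E ⟨0, hd0⟩) s 𝔮 (hEs ▸ heq) x hx O'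

/-- **Case (ii), the derivation.** Let `𝔭` be a maximal ideal of the finitely generated `k`-domain
`A` (characteristic `p`) with `A_𝔭` regular, `a : Fin d → A` a regular system of parameters of
`A_𝔭`, and `u ∈ A` with `u - b^p ∉ 𝔭` for all `b` (the residue of `u` is not a `p`-th power).
Then `E(u) ∉ 𝔭` for some derivation `E ∈ Der(A)`: in `A[Y]` the kernel `𝔔` of
`A[Y] → κ(𝔭)[Y]/(Y^p - ū)` (a field) is a maximal ideal over `𝔭`, of height `ht 𝔭 + 1 = d + 1`,
and `𝔔 A[Y]_𝔔` is generated by the `d + 1` elements `(Y^p - u, a)`, so `A[Y]_𝔔` is regular with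
this regular system of parameters; the derivation `E_0` dual to `Y^p - u`
(`exists_derivations_dual_of_finiteType`) has `E_0(u) = -E_0(Y^p - u) = -e ∉ 𝔔`, and some
coefficient functional of `E_0|_A` is the required `E`. -/
theorem exists_derivation_apply_notMem (k : Type u) [Field k] (p : ℕ) [hp : Fact p.Prime]
    {A : Type u} [CommRing A] [IsDomain A] [CharP A p] [Algebra k A] [Algebra.FiniteType k A]
    (𝔭 : Ideal A) [h𝔭 : 𝔭.IsMaximal] (O : Type v) [CommRing O] [Algebra A O]
    [IsLocalization.AtPrime O 𝔭] [IsRegularLocalRing O] {d : ℕ} (a : Fin d → A)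
    (ha : Ideal.span (Set.range fun i => algebraMap A O (a i)) = maximalIdeal O)
    (hd : ringKrullDim O = d) (u : A) (hup : ∀ b : A, u - b ^ p ∉ 𝔭) :
    ∃ E : Derivation ℤ A A, E u ∉ 𝔭 := by
  classical
  haveI : IsNoetherianRing A := Algebra.FiniteType.isNoetherianRing k A
  -- the residue field `κ = A/𝔭` and the field `F = κ[Y]/(Y^p - ū)`
  letI : Field (A ⧸ 𝔭) := Ideal.Quotient.field 𝔭
  let res : A →+* A ⧸ 𝔭 := Ideal.Quotient.mk 𝔭
  have hres : Function.Surjective res := Ideal.Quotient.mk_surjective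
  have hū : ∀ β : A ⧸ 𝔭, β ^ p ≠ res u := by
    intro β hβ
    obtain ⟨b, rfl⟩ := hres β
    refine hup b (Ideal.Quotient.eq_zero_iff_mem.mp ?_)
    change res (u - b ^ p) = 0
    rw [map_sub, map_pow, ← hβ, sub_self]
  let g : Polynomial (A ⧸ 𝔭) := Polynomial.X ^ p - Polynomial.C (res u)
  haveI hirr : Fact (Irreducible g) := ⟨X_pow_sub_C_irreducible_of_prime hp.out hū⟩
  let ψ : Polynomial A →+* AdjoinRoot g := (AdjoinRoot.mk g).comp (Polynomial.mapRingHom res)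
  have hψsurj : Function.Surjective ψ :=
    AdjoinRoot.mk_surjective.comp (Polynomial.map_surjective res hres)
  let 𝔔 : Ideal (Polynomial A) := RingHom.ker ψ
  haveI h𝔔 : 𝔔.IsMaximal := RingHom.ker_isMaximal_of_surjective ψ hψsurj
  -- members of `𝔔`
  let gA : Polynomial A := Polynomial.X ^ p - Polynomial.C u
  have hψC : ∀ w : A, ψ (Polynomial.C w) = AdjoinRoot.of g (res w) := fun w => by
    simp only [ψ, RingHom.coe_comp, Function.comp_apply, Polynomial.coe_mapRingHom,
      Polynomial.map_C, AdjoinRoot.mk_C]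
  have hgA : gA ∈ 𝔔 := by
    change ψ gA = 0
    simp only [ψ, gA, RingHom.coe_comp, Function.comp_apply, Polynomial.coe_mapRingHom,
      Polynomial.map_sub, Polynomial.map_pow, Polynomial.map_X, Polynomial.map_C]
    exact AdjoinRoot.mk_self
  have ha𝔭 : ∀ l, a l ∈ 𝔭 := mem_of_span_eq_maximalIdeal 𝔭 O a ha
  have hC𝔔 : ∀ w : A, Polynomial.C w ∈ 𝔔 ↔ w ∈ 𝔭 := by
    intro w
    change ψ (Polynomial.C w) = 0 ↔ _
    rw [hψC, map_eq_zero_iff _ (AdjoinRoot.of g).injective]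
    exact Ideal.Quotient.eq_zero_iff_mem
  have h𝔭𝔔 : 𝔭.map (Polynomial.C : A →+* Polynomial A) ≤ 𝔔 := by
    rw [Ideal.map_le_iff_le_comap]
    exact fun w hw => (hC𝔔 w).mpr hw
  haveI : 𝔔.LiesOver 𝔭 := ⟨by
    ext w
    rw [Ideal.under_def, Ideal.mem_comap, Polynomial.algebraMap_eq]
    exact (hC𝔔 w).symm⟩
  -- `𝔔 = 𝔭[Y] + (Y^p - u)`
  have h𝔔le : 𝔔 ≤ 𝔭.map (Polynomial.C : A →+* Polynomial A) ⊔ Ideal.span {gA} := by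
    intro z hz
    have h1 : AdjoinRoot.mk g (z.map res) = 0 := hz
    rw [AdjoinRoot.mk_eq_zero] at h1
    obtain ⟨q', hq'⟩ := h1
    obtain ⟨q, rfl⟩ := Polynomial.map_surjective res hres q'
    have h2 : z - gA * q ∈ 𝔭.map (Polynomial.C : A →+* Polynomial A) := by
      have h3 : (z - gA * q).map res = 0 := by
        rw [Polynomial.map_sub, Polynomial.map_mul, hq']
        simp only [gA, g, Polynomial.map_sub, Polynomial.map_pow, Polynomial.map_X,
          Polynomial.map_C, sub_self]
      have h4 : z - gA * q ∈ RingHom.ker (Polynomial.mapRingHom res) := h3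
      rwa [Polynomial.ker_mapRingHom, Ideal.mk_ker] at h4
    have : z = (z - gA * q) + gA * q := by ring
    rw [this]
    exact Ideal.add_mem _ (Ideal.mem_sup_left h2)
      (Ideal.mem_sup_right (Ideal.mul_mem_right _ _ (Ideal.mem_span_singleton_self _)))
  -- the local ring `A[Y]_𝔔` and its regular system of parameters `(Y^p - u, a)`
  let aY : Fin (d + 1) → Polynomial A := Fin.cons gA fun l => Polynomial.C (a l)
  have haY𝔔 : ∀ i, aY i ∈ 𝔔 := by
    refine Fin.cases ?_ (fun l => ?_)
    · simpa only [aY, Fin.cons_zero] using hgA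
    · simpa only [aY, Fin.cons_succ] using (hC𝔔 (a l)).mpr (ha𝔭 l)
  have haY : Ideal.span (Set.range fun i => algebraMap (Polynomial A) (Localization.AtPrime 𝔔)
      (aY i)) = maximalIdeal (Localization.AtPrime 𝔔) := by
    apply le_antisymm
    · rw [Ideal.span_le]
      rintro _ ⟨i, rfl⟩
      exact (IsLocalization.AtPrime.to_map_mem_maximal_iff _ 𝔔 _).mpr (haY𝔔 i)
    · rw [← Localization.AtPrime.map_eq_maximalIdeal, Ideal.map_le_iff_le_comap]
      refine h𝔔le.trans (sup_le ?_ ?_)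
      · rw [Ideal.map_le_iff_le_comap]
        intro m hm
        rw [Ideal.mem_comap, Ideal.mem_comap]
        have h1 : algebraMap A O m ∈ (Ideal.span (Set.range a)).map (algebraMap A O) := by
          rw [Ideal.map_span, ← Set.range_comp]
          change _ ∈ Ideal.span (Set.range fun i => algebraMap A O (a i))
          rw [ha]
          exact (IsLocalization.AtPrime.to_map_mem_maximal_iff O 𝔭 m).mpr hm
        obtain ⟨w, hw, hwm⟩ := exists_notMem_mul_mem_of_map_mem 𝔭 h1
        have hwu : IsUnit (algebraMap (Polynomial A) (Localization.AtPrime 𝔔) (Polynomial.C w)) :=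
          (IsLocalization.AtPrime.isUnit_to_map_iff _ 𝔔 _).mpr fun h => hw ((hC𝔔 w).mp h)
        rw [← Ideal.unit_mul_mem_iff_mem _ hwu, ← map_mul, ← map_mul]
        have h2 : Polynomial.C (w * m) ∈ (Ideal.span (Set.range a)).map
            (Polynomial.C : A →+* Polynomial A) := Ideal.mem_map_of_mem _ hwm
        have h3 : ((Ideal.span (Set.range a)).map (Polynomial.C : A →+* Polynomial A)).map
            (algebraMap (Polynomial A) (Localization.AtPrime 𝔔)) ≤
            Ideal.span (Set.range fun i => algebraMap (Polynomial A) (Localization.AtPrime 𝔔)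
              (aY i)) := by
          rw [Ideal.map_span, Ideal.map_span, Ideal.span_le]
          rintro _ ⟨_, ⟨_, ⟨l, rfl⟩, rfl⟩, rfl⟩
          exact Ideal.subset_span ⟨l.succ, by simp only [aY, Fin.cons_succ]⟩
        exact h3 (Ideal.mem_map_of_mem _ h2)
      · rw [Ideal.span_singleton_le_iff_mem, Ideal.mem_comap]
        exact Ideal.subset_span ⟨0, by simp only [aY, Fin.cons_zero]⟩
  have hht : ringKrullDim (Localization.AtPrime 𝔔) = ((d + 1 : ℕ) : WithBot ℕ∞) := by
    rw [IsLocalization.AtPrime.ringKrullDim_eq_height 𝔔, Polynomial.height_eq_height_add_one 𝔭 𝔔]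
    have h := IsLocalization.AtPrime.ringKrullDim_eq_height 𝔭 O
    rw [hd] at h
    have h' : 𝔭.height = d := by exact_mod_cast h.symm
    rw [h']
    rfl
  haveI hreg : IsRegularLocalRing (Localization.AtPrime 𝔔) := by
    apply IsRegularLocalRing.of_spanFinrank_maximalIdeal_le
    rw [hht, ← haY]
    have h1 := Submodule.spanFinrank_span_le_ncard_of_finite (R := Localization.AtPrime 𝔔)
      (Set.finite_range fun i => algebraMap (Polynomial A) (Localization.AtPrime 𝔔) (aY i))
    have h2 := Set.ncard_image_le
      (f := fun i => algebraMap (Polynomial A) (Localization.AtPrime 𝔔) (aY i))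
      (s := Set.univ) Set.finite_univ
    rw [Set.image_univ, Set.ncard_univ, Nat.card_eq_fintype_card, Fintype.card_fin] at h2
    exact_mod_cast h1.trans h2
  -- dual derivations of `A[Y]`
  haveI : Algebra.FiniteType k (Polynomial A) :=
    Algebra.FiniteType.trans (S := A) inferInstance inferInstance
  obtain ⟨E, e, he𝔔, hE⟩ :=
    exists_derivations_dual_of_finiteType k 𝔔 (Localization.AtPrime 𝔔) aY haY hht
  have hE0 : E 0 (Polynomial.C u) = -e := by
    have h1 : Polynomial.C u = Polynomial.X ^ p - aY 0 := by
      simp only [aY, Fin.cons_zero, gA, sub_sub_cancel]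
    rw [h1, map_sub, derivation_apply_pow_charP p (E 0), zero_sub, hE, if_pos rfl]
  -- some coefficient of `e` lies outside `𝔭`
  have hcoeff : ∃ i, e.coeff i ∉ 𝔭 := by
    by_contra hall
    push Not at hall
    exact he𝔔 (h𝔭𝔔 (Ideal.mem_map_C_iff.mpr hall))
  obtain ⟨i, hi⟩ := hcoeff
  refine ⟨(Polynomial.lcoeff A i).compDer ((E 0).compAlgebraMap A), fun hmem => hi ?_⟩
  have h1 : (Polynomial.lcoeff A i).compDer ((E 0).compAlgebraMap A) u = (-e).coeff i := by
    change (E 0 (algebraMap A (Polynomial A) u)).coeff i = _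
    rw [Polynomial.algebraMap_eq, hE0]
  rw [h1, Polynomial.coeff_neg] at hmem
  exact (Ideal.neg_mem_iff _).mp hmem

/-- **Case (ii): `x = u` a unit at `v` whose residue is not a `p`-th power.** Then `x` is of
regular type at every localisation near `𝔭` (`exists_derivation_apply_notMem` and
`regularType_of_derivation_apply_notMem`). -/
theorem spreads_of_unit (k : Type u) [Field k] (p : ℕ) (hp : p.Prime) {A : Type u}
    [CommRing A] [IsDomain A] [CharP A p] [Algebra k A] [Algebra.FiniteType k A]
    {K : Type w} [CommRing K] [Algebra A K] (𝔭 : Ideal A) [𝔭.IsMaximal]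
    (O : Type v) [CommRing O] [Algebra A O] [IsLocalization.AtPrime O 𝔭] [IsRegularLocalRing O]
    (x : K) {d : ℕ} (a : Fin d → A) (u : A)
    (ha : Ideal.span (Set.range fun i => algebraMap A O (a i)) = maximalIdeal O)
    (hd : ringKrullDim O = d) (hx : x = algebraMap A K u)
    (hup : ∀ c : O, algebraMap A O u - c ^ p ∉ maximalIdeal O) :
    ∃ h : A, h ∉ 𝔭 ∧ ∀ (𝔮 : Ideal A) [𝔮.IsPrime], h ∉ 𝔮 → 𝔮 ≠ 𝔭 →
      ∀ (O' : Type v) [CommRing O'] [Algebra A O'] [IsLocalization.AtPrime O' 𝔮]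
        [IsRegularLocalRing O'] [Algebra O' K] [IsScalarTower A O' K],
      ((∃ (d m : ℕ) (hmd : m ≤ d) (t : Fin d → O') (a : Fin m → ℕ) (u : O'), IsUnit u ∧
          Ideal.span (Set.range t) = maximalIdeal O' ∧
          ringKrullDim O' = (d : WithBot ℕ∞) ∧ 0 < m ∧ (∀ i, ¬ p ∣ a i) ∧
          x = algebraMap O' K (u * ∏ i : Fin m, t (Fin.castLE hmd i) ^ (a i))) ∨
        (∃ u : O', IsUnit u ∧ x = algebraMap O' K u ∧
          ∀ c' : O', u - c' ^ p ∉ maximalIdeal O') ∨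
        (∃ s c' : O', x = algebraMap O' K s ∧
          s - c' ^ p ∈ maximalIdeal O' ∧ s - c' ^ p ∉ maximalIdeal O' ^ 2)) := by
  haveI : Fact p.Prime := ⟨hp⟩
  have hup' : ∀ b : A, u - b ^ p ∉ 𝔭 := fun b hb => hup (algebraMap A O b) (by
    rw [← map_pow, ← map_sub]
    exact (IsLocalization.AtPrime.to_map_mem_maximal_iff O 𝔭 _).mpr hb)
  obtain ⟨E, hE⟩ := exists_derivation_apply_notMem k p 𝔭 O a ha hd u hup'
  refine ⟨E u, hE, fun 𝔮 _ heq _ O' _ _ _ _ _ _ => Or.inr ?_⟩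
  exact regularType_of_derivation_apply_notMem p hp E u 𝔮 heq x hx O'

end Summit.ResolutionOfSingularities.ResolutionOfSingularities.Theorems.RadicialJung.CleanModels

end
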